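import Literature.NumberTheory.Automorphic.IwahoriDiagonalDecomposition
import Literature.NumberTheory.Automorphic.IwahoriUpMultiplicative
import Mathlib.Algebra.Group.Subgroup.Pointwise
import HarnessLib

/-!
# Unipotent coset representatives of `U(c,c) t_v^a U(c,c)` are permuted by `U(b',c)`

Topic `NumberTheory/Automorphic`; namespace `Literature.NumberTheory.Automorphic.BigHeckeGLn`;
theorems only (no new definitions, no named fact, no `sorry`).

Group theory behind the *adapted family* hypothesis (`LevelAction.IsAdaptedFamily`) of the exact
finite-level control (`LevelControlFiniteLevel`) for the Hida levels `U(c,c) ⊴ U(b',c)` of `GL₂`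
(`b' ≤ c`, `1 ≤ c`, `U` maximal above `p`, `v ∣ p`) and the representatives `N(x) t_v^a`
(`x ∈ 𝒪_v` mod `ϖ_v^a`) of `U t_v^a U / U` (`exists_globalUnipotent_coset_eq`):

* `glDiagonal_mul_localUnipotent_mul_inv`, `diamondElement_mul_globalUnipotent_mul_inv` —
  `diag(u) N(x) diag(u)⁻¹ = N(u₀ x u₁⁻¹)`;
* `exists_conj_globalUnipotent_of_mem_closure` — every `d` in the subgroup generated by diamond
  elements conjugates `N(x)` to some `N(x')` with `v(x') = v(x)`, and commutes with `t_v^a`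
  (`mul_heckeElement_pow_of_mem_closure_diamond`);
* **`TameLevel.exists_globalUnipotent_mul_eq`** — for `l ∈ U(b',c)` and integral `x` there are an
  integral `x'` and `u' ∈ U(b',c)` with `l⁻¹ u' ∈ U(c,c)` and `l · N(x) t^a = N(x') t^a · u'`
  (`1 ≤ a ≤ c`): write `l = m d` with `m ∈ U(c,c)` and `d` a product of diamond elements
  (`exists_mem_closure_diamond_mul_inv_mem_level`), move `d` across `N(x) t^a`, and use the coset
  decomposition at level `U(c,c)`. [cite: KhareThorne2017, §6.2–6.3] [cite: Hida1994AIF, §3]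
* `TameLevel.conj_mem_level_of_mem_level` — `U(c,c)` is normal in `U(b',c)`.

## References

* C. Khare, J. A. Thorne, Amer. J. Math. 139 (2017), §6.2–6.3. [KhareThorne2017]
* H. Hida, Ann. Inst. Fourier 44 (1994), §3. [Hida1994AIF]
-/

noncomputable section

open scoped NumberField
open IsDedekindDomain

namespace Literature.NumberTheory.Automorphic

namespace BigHeckeGLn

variable {K : Type} [Field K] [NumberField K] (v : HeightOneSpectrum (𝓞 K))

/-- `diag(d) n(x) = n(d₀ x d₁⁻¹) diag(d)`. [folklore] -/
theorem glDiagonal_mul_localUnipotent (d : Fin 2 → (v.adicCompletion K)ˣ) (x : v.adicCompletion K) :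
    glDiagonal 2 (v.adicCompletion K) d * localUnipotent v x =
      localUnipotent v ((d 0 : v.adicCompletion K) * x * ((d 1)⁻¹ : (v.adicCompletion K)ˣ)) *
        glDiagonal 2 (v.adicCompletion K) d := by
  refine Matrix.GeneralLinearGroup.ext fun i j => ?_
  rw [Matrix.GeneralLinearGroup.coe_mul, Matrix.GeneralLinearGroup.coe_mul, coe_localUnipotent,
    coe_localUnipotent, coe_glDiagonal, Matrix.diagonal_mul, Matrix.mul_diagonal]
  fin_cases i <;> fin_cases j <;> simp [mul_assoc]

/-- `⟨u⟩_v N(x) ⟨u⟩_v⁻¹ = N(u₀ x u₁⁻¹)`. [folklore] -/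
theorem diamondElement_mul_globalUnipotent_mul_inv (u : Fin 2 → (v.adicCompletionIntegers K)ˣ)
    (x : v.adicCompletion K) :
    diamondElement 2 K v u * globalUnipotent K v x * (diamondElement 2 K v u)⁻¹ =
      globalUnipotent K v ((unitsToLocal 2 v u 0 : (v.adicCompletion K)ˣ) * x *
        ((unitsToLocal 2 v u 1)⁻¹ : (v.adicCompletion K)ˣ)) := by
  rw [diamondElement_apply, globalUnipotent, globalUnipotent, ← map_mul, glDiagonal_mul_localUnipotent,
    map_mul, mul_inv_cancel_right]

/-- `⟨u⟩_w` commutes with `N(x)` (`x` at `v`) for `w ≠ v`. [folklore] -/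
theorem diamondElement_mul_globalUnipotent_of_ne {w : HeightOneSpectrum (𝓞 K)} (hwv : w ≠ v)
    (u : Fin 2 → (w.adicCompletionIntegers K)ˣ) (x : v.adicCompletion K) :
    diamondElement 2 K w u * globalUnipotent K v x = globalUnipotent K v x * diamondElement 2 K w u := by
  rw [globalUnipotent]
  exact mul_ofLocal_comm (by rw [diamondElement_apply, localComponent_ofLocal_of_ne (Ne.symm hwv)]) _

/-- **Products of diamond elements conjugate `N(x)` to `N(x')` with `v(x') = v(x)`.** [folklore] -/
theorem exists_conj_globalUnipotent_of_mem_closure {p : ℕ} {S : Set (FiniteAdelicGL 2 K)}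
    (hS : ∀ y ∈ S, ∃ (w : HeightOneSpectrum (𝓞 K)) (_ : (p : 𝓞 K) ∈ w.asIdeal)
      (u : Fin 2 → (w.adicCompletionIntegers K)ˣ), y = diamondElement 2 K w u)
    {d : FiniteAdelicGL 2 K} (hd : d ∈ Subgroup.closure S) (x : v.adicCompletion K) :
    ∃ x' : v.adicCompletion K, Valued.v x' = Valued.v x ∧
      d * globalUnipotent K v x * d⁻¹ = globalUnipotent K v x' := by
  classical
  -- generators and their inverses
  have gen : ∀ (w : HeightOneSpectrum (𝓞 K)) (u : Fin 2 → (w.adicCompletionIntegers K)ˣ)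
      (x : v.adicCompletion K), ∃ x' : v.adicCompletion K, Valued.v x' = Valued.v x ∧
        diamondElement 2 K w u * globalUnipotent K v x * (diamondElement 2 K w u)⁻¹ =
          globalUnipotent K v x' := by
    intro w u x
    by_cases hwv : w = v
    · subst hwv
      refine ⟨_, ?_, diamondElement_mul_globalUnipotent_mul_inv w u x⟩
      rw [map_mul, map_mul, valued_unitsToLocal, one_mul, map_units_inv, valued_unitsToLocal, inv_one,
        mul_one]
    · exact ⟨x, rfl, by rw [diamondElement_mul_globalUnipotent_of_ne v hwv, mul_inv_cancel_right]⟩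
  induction hd using Subgroup.closure_induction'' generalizing x with
  | mem y hy =>
    obtain ⟨w, -, u, rfl⟩ := hS y hy
    exact gen w u x
  | inv_mem y hy =>
    obtain ⟨w, -, u, rfl⟩ := hS y hy
    rw [← map_inv]
    exact gen w u⁻¹ x
  | one => exact ⟨x, rfl, by rw [one_mul, inv_one, mul_one]⟩
  | mul y z _ _ ihy ihz =>
    obtain ⟨x₁, h₁, e₁⟩ := ihz x
    obtain ⟨x₂, h₂, e₂⟩ := ihy x₁
    refine ⟨x₂, h₂.trans h₁, ?_⟩
    rw [mul_inv_rev, show y * z * globalUnipotent K v x * (z⁻¹ * y⁻¹) =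
      y * (z * globalUnipotent K v x * z⁻¹) * y⁻¹ by group, e₁, e₂]

/-- `⟨u⟩_w t_v^a = t_v^a ⟨u⟩_w` (as in `HidaLatticeDiamondAction`). [folklore] -/
theorem diamondElement_mul_heckeElement_pow (w : HeightOneSpectrum (𝓞 K))
    (u : Fin 2 → (w.adicCompletionIntegers K)ˣ) (a : ℕ) :
    diamondElement 2 K w u * heckeElement 2 K v 1 ^ a = heckeElement 2 K v 1 ^ a * diamondElement 2 K w u := by
  rw [heckeElement_one_pow_eq_ofLocal v a]
  by_cases hvw : w = v
  · subst hvw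
    rw [diamondElement_apply, cutDiag, ← map_mul, ← map_mul, ← map_mul, ← map_mul, mul_comm]
  · exact mul_ofLocal_comm (by rw [diamondElement_apply, localComponent_ofLocal_of_ne (Ne.symm hvw)]) _

/-- Products of diamond elements commute with `t_v^a`. [folklore] -/
theorem mul_heckeElement_pow_of_mem_closure_diamond {p : ℕ} {S : Set (FiniteAdelicGL 2 K)}
    (hS : ∀ y ∈ S, ∃ (w : HeightOneSpectrum (𝓞 K)) (_ : (p : 𝓞 K) ∈ w.asIdeal)
      (u : Fin 2 → (w.adicCompletionIntegers K)ˣ), y = diamondElement 2 K w u)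
    {d : FiniteAdelicGL 2 K} (hd : d ∈ Subgroup.closure S) (a : ℕ) :
    d * heckeElement 2 K v 1 ^ a = heckeElement 2 K v 1 ^ a * d := by
  have hle : Subgroup.closure S ≤ Subgroup.centralizer {heckeElement 2 K v 1 ^ a} := by
    refine (Subgroup.closure_le _).2 fun y hy => ?_
    obtain ⟨w, -, u, rfl⟩ := hS y hy
    rw [SetLike.mem_coe, Subgroup.mem_centralizer_singleton_iff]
    exact diamondElement_mul_heckeElement_pow v w u a
  exact (Subgroup.mem_centralizer_singleton_iff).1 (hle hd)

/-- The generating set of `exists_mem_closure_diamond_mul_inv_mem_level` consists of diamond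
elements. [folklore] -/
theorem forall_mem_diamondGens_exists (p b' : ℕ) :
    ∀ y ∈ {x : FiniteAdelicGL 2 K | ∃ (v : HeightOneSpectrum (𝓞 K))
        (_ : (p : 𝓞 K) ∈ v.asIdeal) (u : Fin 2 → (v.adicCompletionIntegers K)ˣ),
        (∀ j, Valued.v ((((u j : (v.adicCompletionIntegers K)ˣ) : v.adicCompletionIntegers K) :
          v.adicCompletion K) - 1) ≤ WithZero.exp (-(b' : ℤ))) ∧ x = diamondElement 2 K v u},
      ∃ (w : HeightOneSpectrum (𝓞 K)) (_ : (p : 𝓞 K) ∈ w.asIdeal)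
        (u : Fin 2 → (w.adicCompletionIntegers K)ˣ), y = diamondElement 2 K w u :=
  fun _ ⟨w, hw, u, _, hy⟩ => ⟨w, hw, u, hy⟩

namespace TameLevel

variable {p : ℕ} [Fact p.Prime] (𝒰 : TameLevel 2 K p) {v}

/-- **`U(c,c)` is normal in `U(b',c)`** (`1 ≤ c`): conjugation by `U(b',c) = D · U(c,c)`
(`exists_mem_closure_diamond_mul_inv_mem_level`, `conj_mem_level_of_mem_closure_diamond`).
[cite: KhareThorne2017, §6.3] -/
theorem conj_mem_level_of_mem_level (h𝒰 : 𝒰.IsMaximalAbove) {b' c : ℕ} (hc : 1 ≤ c)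
    {l : FiniteAdelicGL 2 K} (hl : l ∈ 𝒰.level b' c) {m : FiniteAdelicGL 2 K}
    (hm : m ∈ 𝒰.level c c) : l⁻¹ * m * l ∈ 𝒰.level c c := by
  obtain ⟨d, hdD, hld⟩ := 𝒰.exists_mem_closure_diamond_mul_inv_mem_level h𝒰 (le_refl c)
    (le_max_of_le_right hc) hl
  have h1 : (l * d⁻¹)⁻¹ * m * (l * d⁻¹) ∈ 𝒰.level c c :=
    mul_mem (mul_mem (inv_mem hld) hm) hld
  have h2 := 𝒰.conj_mem_level_of_mem_closure_diamond h𝒰 c c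
    (forall_mem_diamondGens_exists (K := K) p b') hdD h1
  rwa [show d⁻¹ * ((l * d⁻¹)⁻¹ * m * (l * d⁻¹)) * d = l⁻¹ * m * l by group] at h2

/-- **`l · N(x) t^a = N(x') t^a · u'`** with `u' ∈ U(b',c)`, `l⁻¹ u' ∈ U(c,c)`, `x'` integral, for
`l ∈ U(b',c)`, `x` integral, `a ≤ c`, `b' ≤ c`, `1 ≤ c`: the representatives `N(x) t_v^a` of
`U(c,c) t_v^a U(c,c) / U(c,c)` are permuted by left multiplication by `U(b',c)` up to right
factors in `U(b',c)` congruent to the multiplier modulo `U(c,c)` — the adapted-family property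
behind the `U_p`-compatibility of restriction and transfer between the levels `U(c,c) ⊴ U(b',c)`.
[cite: KhareThorne2017, §6.2–6.3] [cite: Hida1994AIF, §3] -/
theorem exists_globalUnipotent_mul_eq (h𝒰 : 𝒰.IsMaximalAbove) (hv : (p : 𝓞 K) ∈ v.asIdeal)
    {b' c a : ℕ} (ha : a ≤ c) (hb' : b' ≤ c) (hc : 1 ≤ c) {l : FiniteAdelicGL 2 K}
    (hl : l ∈ 𝒰.level b' c) {x : v.adicCompletion K} (hx : Valued.v x ≤ 1) :
    ∃ (x' : v.adicCompletion K) (u' : FiniteAdelicGL 2 K), Valued.v x' ≤ 1 ∧ u' ∈ 𝒰.level b' c ∧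
      l⁻¹ * u' ∈ 𝒰.level c c ∧
      l * (globalUnipotent K v x * heckeElement 2 K v 1 ^ a) =
        globalUnipotent K v x' * heckeElement 2 K v 1 ^ a * u' := by
  have hS := forall_mem_diamondGens_exists (K := K) p b'
  -- `l = m d`, `m = l d⁻¹ ∈ U(c,c)`, `d ∈ D ≤ U(b',c)`
  obtain ⟨d, hdD, hld⟩ := 𝒰.exists_mem_closure_diamond_mul_inv_mem_level h𝒰 (le_refl c)
    (le_max_of_le_right hc) hl
  have hdU : d ∈ 𝒰.level b' c := 𝒰.closure_diamond_le_level h𝒰 b' c hdD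
  -- `d N(x) d⁻¹ = N(x₁)`
  obtain ⟨x₁, hx₁v, hx₁⟩ := exists_conj_globalUnipotent_of_mem_closure v hS hdD x
  have hx₁1 : Valued.v x₁ ≤ 1 := hx₁v ▸ hx
  -- coset decomposition at level `U(c,c)` of `(l d⁻¹ N(x₁)) t^a`
  have hmN : l * d⁻¹ * globalUnipotent K v x₁ ∈ 𝒰.level c c :=
    mul_mem hld ((𝒰.globalUnipotent_mem_level_iff h𝒰 hv c c x₁).2 hx₁1)
  obtain ⟨x', hx'1, hcoset⟩ := 𝒰.exists_globalUnipotent_coset_eq h𝒰 hv ha hmN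
  set t : FiniteAdelicGL 2 K := heckeElement 2 K v 1 ^ a with ht
  set m'' : FiniteAdelicGL 2 K :=
    (globalUnipotent K v x' * t)⁻¹ * (l * d⁻¹ * globalUnipotent K v x₁ * t) with hm''
  have hm''U : m'' ∈ 𝒰.level c c := by
    rw [hm'', ← QuotientGroup.eq]
    exact hcoset.symm
  have hkey : globalUnipotent K v x' * t * m'' = l * d⁻¹ * globalUnipotent K v x₁ * t := by
    rw [hm'', mul_inv_cancel_left]
  have hdt : d * t = t * d := mul_heckeElement_pow_of_mem_closure_diamond v hS hdD a
  have hdN : d * globalUnipotent K v x = globalUnipotent K v x₁ * d := by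
    rw [← hx₁, inv_mul_cancel_right]
  refine ⟨x', m'' * d, hx'1, mul_mem (𝒰.level_antitone hb' le_rfl hm''U) hdU, ?_, ?_⟩
  · have h1 : (l * d⁻¹)⁻¹ * m'' ∈ 𝒰.level c c := mul_mem (inv_mem hld) hm''U
    have h2 := 𝒰.conj_mem_level_of_mem_closure_diamond h𝒰 c c hS hdD h1
    rwa [show d⁻¹ * ((l * d⁻¹)⁻¹ * m'') * d = l⁻¹ * (m'' * d) by group] at h2
  · rw [← mul_assoc (globalUnipotent K v x' * t) m'' d, hkey,
      mul_assoc (l * d⁻¹ * globalUnipotent K v x₁) t d, ← hdt,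
      ← mul_assoc (l * d⁻¹ * globalUnipotent K v x₁) d t,
      mul_assoc (l * d⁻¹) (globalUnipotent K v x₁) d, ← hdN]
    group

end TameLevel

end BigHeckeGLn

end Literature.NumberTheory.Automorphic
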